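import Literature.Topology.FourManifolds.PropertyRStrict
import Literature.Topology.FourManifolds.RLinkSphere
import Literature.Topology.FourManifolds.KirbyCalculus
import HarnessLib

/-!
# Helper `helper_stdSphereSlides_of_strictGPRC` of line `sphere_split` for crux
`VerlindeRLinks.VrlSliceRigidity` (item stmt-SmoothPoincare4-16179, route route-SmoothPoincare4-VerlindeRLinks)

**The heart `stub_stdSphereSlides` of the line ("generalised Property R on the standard `S⁴`")
is a special case of the printed Generalised Property R conjecture.** The printed conjecture
`Literature.Topology.FourManifolds.StrictGeneralizedPropertyRConjecture` (Gompf–Scharlemann–Thompson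
2010, §2 Conjecture 1; Kirby 1997, Problem 1.82; an open `def … : Prop`, used here only as a
HYPOTHESIS) says: for every `n`, every `n`-component framed link `L ⊂ S³` and every closed smooth
`Y ≅ #ⁿ(S² × S¹)` which is integral surgery on `L`, the link `L` is strictly handle-slide
equivalent (`IsStrictHandleSlideEquivalent`: isotopy, renumbering, reversal, `2`-handle slides
along bands missing the other components and the collar annulus) to a `0`-framed split unlink.
The heart asks the same conclusion only for those R-links some closed manifold `X` of which
(`IsRLinkSphere X L`, the `1`-handle-free handlebody `0h ∪ (2-handles along L) ∪ n·3h ∪ 4h`,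
GST §9) is diffeomorphic to the round `S⁴`; so the heart follows from the conjecture by dropping
the two sphere hypotheses.

Why it is recorded: it is the upper half of the sandwich locating the heart — `n = 0` trivial,
`n = 1` Gabai's Property R, general `n` between "GPRC on the standard sphere" (this stub) and the
full printed GPRC (this file: GPRC ⇒ stub); GST §9, p. 19: "If the `2`-handles attached along `L`
can be slid so that the attaching link is the unlink, this would show that `W ≅ S⁴`".

Sources: R. E. Gompf, M. Scharlemann, A. Thompson, *Fibered knots and potential counterexamples to
the Property 2R and Slice-Ribbon Conjectures*, Geom. Topol. 14 (2010), §2 Conjecture 1, §9;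
R. Kirby (ed.), *Problems in low-dimensional topology* (1997), Problem 1.82.

The file declares one theorem (pure logic over the tree's definitions: intro; exact).
-/

noncomputable section

set_option linter.dupNamespace false

namespace Summit.SmoothPoincare4.SmoothPoincare4.Theorems.VrlSliceRigidity.SphereSplit

open scoped Manifold ContDiff Topology
open Set Function Literature.Topology.FourManifolds

/-- Local notation: `𝔼 n` is the model Euclidean space `EuclideanSpace ℝ (Fin n)`. -/
local notation "𝔼 " n:arg => EuclideanSpace ℝ (Fin n)

/-- Local notation: `𝕊 n` is the unit sphere in `EuclideanSpace ℝ (Fin (n + 1))`. -/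
local notation "𝕊 " n:arg => (Metric.sphere (0 : EuclideanSpace ℝ (Fin (n + 1))) 1)

/-- **The printed Generalised Property R conjecture implies GPRC on the standard sphere** (the
heart `stub_stdSphereSlides` of line `sphere_split`): under
`StrictGeneralizedPropertyRConjecture`, every framed link `L` with `n` components whose integral
surgery is some closed smooth `Y ≅ #ⁿ(S² × S¹)` is strictly handle-slide equivalent to a `0`-framed
split unlink — in particular when, in addition, some closed manifold `X` of `L`
(`IsRLinkSphere X L`) is diffeomorphic to `S⁴`; the two sphere hypotheses are simply dropped.
Gompf–Scharlemann–Thompson (2010), §2 Conjecture 1 and §9. [folklore] -/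
theorem helper_stdSphereSlides_of_strictGPRC : ∀ [Knot.TubularNbhd.SmoothnessFacts], StrictGeneralizedPropertyRConjecture → ∀ (n : ℕ) (L : FramedLink (Fin n)) (Y : Type) [TopologicalSpace Y] [T2Space Y] [SecondCountableTopology Y] [ChartedSpace (𝔼 3) Y] [IsManifold (𝓡 3) ∞ Y] [CompactSpace Y] [ConnectedSpace Y], IsSphereTwoProdCircleSum n Y → L.IsSurgery (𝓡 3) Y → ∀ (X : Type) [TopologicalSpace X] [T2Space X] [SecondCountableTopology X] [ChartedSpace (𝔼 4) X] [IsManifold (𝓡 4) ∞ X], IsRLinkSphere X L → Nonempty (X ≃ₘ⟮𝓡 4, 𝓡 4⟯ 𝕊 4) → ∃ U : FramedLink (Fin n), U.IsZeroFramedUnlink ∧ IsStrictHandleSlideEquivalent ⟨n, L⟩ ⟨n, U⟩ := by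
  intro _ h n L Y _ _ _ _ _ _ _ hY hL X _ _ _ _ _ _hX _hstd
  exact h n L Y hY hL

end Summit.SmoothPoincare4.SmoothPoincare4.Theorems.VrlSliceRigidity.SphereSplit

end
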